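import Literature.MathematicalPhysics.QuantumFieldTheory.Balaban1983to89.B10Eq27TorusAxialLog
import Literature.MathematicalPhysics.QuantumFieldTheory.Balaban1983to89.B9Eq310Hermitian
import Literature.MathematicalPhysics.QuantumFieldTheory.Balaban1983to89.B9TorusCalculus
import Mathlib.Analysis.CStarAlgebra.Matrix
import HarnessLib

/-!
# Route `UnitScaleTilt`, crux K1 «MinimiserStabilityRegPr» (stmt-QuantumFields-19200), route-R E′ path (α′), (E1-d′)∕(E1-e) seam: SOCKET ROWS AT THE TREE LETTERS —
# the inputs of `Prop7GaugeRowsMaxSup` (additivity + crude sup bounds of `D_W` and `Δ_W = divB ∘ covD`) and of `Prop7ExactCorrectorContractionGauge` (closedness of the pinned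
# Hermitian-traceless set, completeness of the site-field carrier) for the covariant lattice operators of [Balaban1985BackgroundPropagators] (3.3)∕(3.8) at a unitary background

Cell `ym3-torus`, width seat `ym3-torus-px13` (gen 3); offer «px13: (E1-e-σ) SOCKET ROWS AT THE TREE LETTERS» (bus 2026-08-28T21:03Z), sequel of ✓p667460 (door) and ✓p667764 (gauge rows).
THEOREMS ONLY (0 `def`, 0 `sorry`, 0 `instance`); `--supports stmt-QuantumFields-19200`, count-neutral.  YM₃ on T³ is a ladder rung (R3), not the Clay problem; nothing here
claims the stub, the crux, d = 4 or the gap.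

WHAT IS PROVED (ns `…Theorems.Prop7ExactCorrectorGaugeSockets`).
§1 GENERIC (`𝔸` a normed ring, finite site set `S`, finite direction set `ι`, shifts `T : ι → Equiv.Perm S`, background `U : ι → S → 𝔸ˣ`; lit `B9Eq39Adjoint.covD∕covDstar∕divB`):
* (σ1) `covD_field_sub` — `(fun μ z => covD T U μ (a − b) z) = (fun μ z => covD T U μ a z) − (fun μ z => covD T U μ b z)`; `divB_sub`; (σ2) `lapW_field_sub` — the same for
  `Δ_U := fun ψ x => divB T U (fun μ z => covD T U μ ψ z) x`.
* (with lit `B9Eq310Hermitian.norm_R_le`: `‖R(V)X‖ ≤ ‖X‖` for `‖V‖, ‖V⁻¹‖ ≤ 1`) (σ3) `norm_covD_le`∕`norm_covD_field_le` — `‖D_{U,μ}ψ(z)‖ ≤ 2‖ψ‖`, `‖(fun μ z => covD T U μ ψ z)‖ ≤ 2‖ψ‖` (Pi sup norms),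
  `norm_covDstar_le`, `norm_divB_le` — `‖(D*A)(x)‖ ≤ 2·|ι|·‖A‖`, (σ4) `norm_lapW_le`∕`norm_lapW_field_le` — `‖Δ_Uψ(x)‖ ≤ 4·|ι|·‖ψ‖` — all for `‖U‖, ‖U⁻¹‖ ≤ 1` bondwise.
§2 CLOSEDNESS (σ5): `isClosed_pinned_mem` — `{ψ : S → 𝔸 | (∀ c ∈ C, ψ c = 0) ∧ ∀ x, ψ x ∈ K}` is closed for closed `K` (any topological `𝔸` with closed points);
`isClosed_herm_traceZero` — `{A : M_N(ℂ) | Aᴴ = A ∧ tr A = 0}` is closed in the `L²`-operator-norm topology (scope `Matrix.Norms.L2Operator`, the E′ files' norm);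
`isClosed_pinned_herm_traceZero` — the (E1-e) set `S = {ψ | ψ|_C = 0, ψ(x)ᴴ = ψ(x), tr ψ(x) = 0}`.
§3 THE E′ READING (σ3′)(σ4′)(σ6): at `T := torusT P j`, `𝒰 := fun κ z => unitsField (toUField W) ⟨z, κ⟩` for an `SU(N)`-valued torus configuration `W` (`N ≠ 0`):
`unitsField_toUField_norm_le_one` (both `‖𝒰‖ ≤ 1` and `‖𝒰⁻¹‖ ≤ 1`), `norm_covD_field_le_T` (`≤ 2‖ψ‖`), `norm_lapW_field_le_T` (`≤ 4d‖ψ‖`), `completeSpace_siteField`.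
§4 (v1.1, X-row 3 := ρ₃ adopted 2026-08-28T21:18Z, ym-routeR-w3 g5 after ym3-torus-px4's pin-cone hazard) THE WEIGHTED SECOND-ORDER ROW: for a real weight `0 ≤ w ≤ wmax`
(the knit's `w x := min(dist(x,C), ℓ)`, `wmax := ℓ`), `T₂ʷ ψ := fun x => (w x : ℂ) • Δ_Uψ(x)` is additive (`wlapW_field_sub`) with `‖T₂ʷ ψ‖ ≤ wmax·4|ι|·‖ψ‖` (`norm_wlapW_field_le`,
torus reading `norm_wlapW_field_le_T`), so `ρ₃(ψ) = ℓ·‖T₂ʷ ψ‖` is again a row of the shape ✓p667764 consumes (`ℓ₂ := ℓ`, `a₂ := 4d·ℓ`).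
HONEST SCOPE.  Elementary bookkeeping so that the (E1-e) knit instantiates ✓p667764 (`T₁ := D_W`, `T₂ := Δ_W`, `a₁ = 2`, `a₂ = 4d`) and ✓p667460 (`hS`, `CompleteSpace X`) by `exact`.

References: T. Bałaban, CMP 99 (1985) 389–434 [Balaban1985BackgroundPropagators] ((3.3) p.390, (3.8) p.392); CMP 102 (1985) 277–309 [Balaban1985Variational] (Prop. 7 p.299).
-/

set_option autoImplicit false

noncomputable section

open scoped BigOperators

namespace Summit.QuantumFields.YangMills.Theorems.Prop7ExactCorrectorGaugeSockets

open Literature.MathematicalPhysics.QuantumFieldTheory.Balaban1983to89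
open B9Eq39Adjoint (R covD covDstar divB covD_sub covDstar_sub)

/-! ## §1 Generic additivity and sup bounds for `D_U`, `D*_U`, `divB`, `Δ_U = divB ∘ covD` -/

section Generic

variable {𝔸 : Type*} [NormedRing 𝔸] {S : Type*} {ι : Type*}
variable (T : ι → Equiv.Perm S) (U : ι → S → 𝔸ˣ)

/-- (σ1) Additivity of the covariant difference as a map into the `Pi` type of bond fields:
`(μ, z) ↦ D_{U,μ}(a − b)(z)` is `D_U a − D_U b`.  [cite: Balaban1985BackgroundPropagators, (3.3) p.390] -/
theorem covD_field_sub (a b : S → 𝔸) :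
    (fun μ z => covD T U μ (a - b) z) = (fun μ z => covD T U μ a z) - (fun μ z => covD T U μ b z) := by
  funext μ z
  simp only [Pi.sub_apply]
  exact covD_sub T U μ a b z

variable [Fintype ι]

/-- The site divergence (3.8) is additive: `D*(A − B) = D*A − D*B`.  [cite: Balaban1985BackgroundPropagators, (3.8) p.392] -/
theorem divB_sub (A B : ι → S → 𝔸) (x : S) : divB T U (A - B) x = divB T U A x - divB T U B x := by
  simp only [divB, Pi.sub_apply, ← Finset.sum_sub_distrib]
  exact Finset.sum_congr rfl fun μ _ => covDstar_sub T U μ (A μ) (B μ) x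

/-- (σ2) Additivity of the covariant Laplacian `Δ_U ψ := divB (D_U ψ)` as a map into site fields.  [cite: Balaban1985BackgroundPropagators, (3.8) p.392] -/
theorem lapW_field_sub (a b : S → 𝔸) :
    (fun x => divB T U (fun μ z => covD T U μ (a - b) z) x) =
      (fun x => divB T U (fun μ z => covD T U μ a z) x) - (fun x => divB T U (fun μ z => covD T U μ b z) x) := by
  funext x
  rw [covD_field_sub T U a b, Pi.sub_apply, divB_sub]

variable [Fintype S]

omit [Fintype ι] in
/-- (σ3) pointwise: `‖D_{U,μ}ψ(z)‖ ≤ 2‖ψ‖` (sup norm of `ψ`) at a background with `‖U‖, ‖U⁻¹‖ ≤ 1`.  [cite: Balaban1985BackgroundPropagators, (3.3) p.390] -/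
theorem norm_covD_le (hU : ∀ μ z, ‖(U μ z : 𝔸)‖ ≤ 1 ∧ ‖(((U μ z)⁻¹ : 𝔸ˣ) : 𝔸)‖ ≤ 1) (ψ : S → 𝔸) (μ : ι) (z : S) :
    ‖covD T U μ ψ z‖ ≤ 2 * ‖ψ‖ := by
  calc ‖covD T U μ ψ z‖ = ‖R (U μ z) (ψ (T μ z)) - ψ z‖ := rfl
    _ ≤ ‖R (U μ z) (ψ (T μ z))‖ + ‖ψ z‖ := norm_sub_le _ _
    _ ≤ ‖ψ (T μ z)‖ + ‖ψ z‖ := by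
        gcongr
        exact B9Eq310Hermitian.norm_R_le (hU μ z).1 (hU μ z).2 _
    _ ≤ ‖ψ‖ + ‖ψ‖ := add_le_add (norm_le_pi_norm ψ _) (norm_le_pi_norm ψ _)
    _ = 2 * ‖ψ‖ := by ring

/-- (σ3) `‖D_Uψ‖ ≤ 2‖ψ‖` in the `Pi` sup norms (the row `hb₁` of `Prop7GaugeRowsMaxSup.gauge_le_mul_norm` with `a₁ = 2`).
[cite: Balaban1985BackgroundPropagators, (3.3) p.390] -/
theorem norm_covD_field_le (hU : ∀ μ z, ‖(U μ z : 𝔸)‖ ≤ 1 ∧ ‖(((U μ z)⁻¹ : 𝔸ˣ) : 𝔸)‖ ≤ 1) (ψ : S → 𝔸) :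
    ‖(fun μ z => covD T U μ ψ z)‖ ≤ 2 * ‖ψ‖ := by
  refine (pi_norm_le_iff_of_nonneg (by positivity)).2 fun μ => ?_
  refine (pi_norm_le_iff_of_nonneg (by positivity)).2 fun z => ?_
  exact norm_covD_le T U hU ψ μ z

omit [Fintype ι] in
/-- `‖D*_{U,μ}G(x)‖ ≤ 2‖G‖` (the reversed-bond difference (3.8)).  [cite: Balaban1985BackgroundPropagators, (3.8) p.392] -/
theorem norm_covDstar_le (hU : ∀ μ z, ‖(U μ z : 𝔸)‖ ≤ 1 ∧ ‖(((U μ z)⁻¹ : 𝔸ˣ) : 𝔸)‖ ≤ 1) (G : S → 𝔸) (μ : ι) (x : S) :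
    ‖covDstar T U μ G x‖ ≤ 2 * ‖G‖ := by
  have h1 : ‖(((U μ ((T μ).symm x))⁻¹ : 𝔸ˣ) : 𝔸)‖ ≤ 1 := (hU μ _).2
  have h2 : ‖((((U μ ((T μ).symm x))⁻¹)⁻¹ : 𝔸ˣ) : 𝔸)‖ ≤ 1 := by rw [inv_inv]; exact (hU μ _).1
  calc ‖covDstar T U μ G x‖ = ‖R (U μ ((T μ).symm x))⁻¹ (G ((T μ).symm x)) - G x‖ := rfl
    _ ≤ ‖R (U μ ((T μ).symm x))⁻¹ (G ((T μ).symm x))‖ + ‖G x‖ := norm_sub_le _ _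
    _ ≤ ‖G ((T μ).symm x)‖ + ‖G x‖ := by
        gcongr
        exact B9Eq310Hermitian.norm_R_le h1 h2 _
    _ ≤ ‖G‖ + ‖G‖ := add_le_add (norm_le_pi_norm G _) (norm_le_pi_norm G _)
    _ = 2 * ‖G‖ := by ring

/-- `‖(D*A)(x)‖ ≤ 2·|ι|·‖A‖` (sup norm of the bond field `A : ι → S → 𝔸`).  [cite: Balaban1985BackgroundPropagators, (3.8) p.392] -/
theorem norm_divB_le (hU : ∀ μ z, ‖(U μ z : 𝔸)‖ ≤ 1 ∧ ‖(((U μ z)⁻¹ : 𝔸ˣ) : 𝔸)‖ ≤ 1) (A : ι → S → 𝔸) (x : S) :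
    ‖divB T U A x‖ ≤ 2 * Fintype.card ι * ‖A‖ := by
  calc ‖divB T U A x‖ = ‖∑ μ, covDstar T U μ (A μ) x‖ := rfl
    _ ≤ ∑ μ, ‖covDstar T U μ (A μ) x‖ := norm_sum_le _ _
    _ ≤ ∑ _μ : ι, 2 * ‖A‖ := Finset.sum_le_sum fun μ _ =>
        (norm_covDstar_le T U hU (A μ) μ x).trans (by gcongr; exact norm_le_pi_norm A μ)
    _ = 2 * Fintype.card ι * ‖A‖ := by
        rw [Finset.sum_const, Finset.card_univ, nsmul_eq_mul]
        ring

/-- (σ4) pointwise: `‖Δ_Uψ(x)‖ ≤ 4·|ι|·‖ψ‖`.  [cite: Balaban1985BackgroundPropagators, (3.8) p.392] -/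
theorem norm_lapW_le (hU : ∀ μ z, ‖(U μ z : 𝔸)‖ ≤ 1 ∧ ‖(((U μ z)⁻¹ : 𝔸ˣ) : 𝔸)‖ ≤ 1) (ψ : S → 𝔸) (x : S) :
    ‖divB T U (fun μ z => covD T U μ ψ z) x‖ ≤ 4 * Fintype.card ι * ‖ψ‖ := by
  have hc : (0 : ℝ) ≤ 2 * Fintype.card ι := by positivity
  calc ‖divB T U (fun μ z => covD T U μ ψ z) x‖ ≤ 2 * Fintype.card ι * ‖(fun μ z => covD T U μ ψ z)‖ := norm_divB_le T U hU _ x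
    _ ≤ 2 * Fintype.card ι * (2 * ‖ψ‖) := mul_le_mul_of_nonneg_left (norm_covD_field_le T U hU ψ) hc
    _ = 4 * Fintype.card ι * ‖ψ‖ := by ring

/-- (σ4) `‖Δ_Uψ‖ ≤ 4·|ι|·‖ψ‖` in the `Pi` sup norms (the row `hb₂` of `Prop7GaugeRowsMaxSup.gauge_le_mul_norm` with `a₂ = 4d`).
[cite: Balaban1985BackgroundPropagators, (3.8) p.392] -/
theorem norm_lapW_field_le (hU : ∀ μ z, ‖(U μ z : 𝔸)‖ ≤ 1 ∧ ‖(((U μ z)⁻¹ : 𝔸ˣ) : 𝔸)‖ ≤ 1) (ψ : S → 𝔸) :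
    ‖(fun x => divB T U (fun μ z => covD T U μ ψ z) x)‖ ≤ 4 * Fintype.card ι * ‖ψ‖ := by
  refine (pi_norm_le_iff_of_nonneg (by positivity)).2 fun x => ?_
  exact norm_lapW_le T U hU ψ x

end Generic

/-! ## §2 Closedness of the pinned ∕ Hermitian-traceless sets (row `hS` of `exists_unique_exact_corrector_gauge`) -/

section Closed

/-- (σ5, generic) For a closed `K ⊆ 𝔸` and any set of pinning sites `C`, the set of fields vanishing on `C` with values in `K` is closed in the product topology.
[cite: Balaban1985Variational, Prop. 7 p.299] -/
theorem isClosed_pinned_mem {S 𝔸 : Type*} [TopologicalSpace 𝔸] [T1Space 𝔸] [Zero 𝔸] (C : Set S) (K : Set 𝔸) (hK : IsClosed K) :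
    IsClosed {ψ : S → 𝔸 | (∀ c ∈ C, ψ c = 0) ∧ ∀ x, ψ x ∈ K} := by
  have h1 : IsClosed {ψ : S → 𝔸 | ∀ c ∈ C, ψ c = 0} := by
    have e : {ψ : S → 𝔸 | ∀ c ∈ C, ψ c = 0} = ⋂ c ∈ C, {ψ : S → 𝔸 | ψ c ∈ ({0} : Set 𝔸)} := by
      ext ψ; simp
    rw [e]
    exact isClosed_biInter fun c _ => isClosed_singleton.preimage (continuous_apply c)
  have h2 : IsClosed {ψ : S → 𝔸 | ∀ x, ψ x ∈ K} := by
    have e : {ψ : S → 𝔸 | ∀ x, ψ x ∈ K} = ⋂ x, {ψ : S → 𝔸 | ψ x ∈ K} := by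
      ext ψ; simp
    rw [e]
    exact isClosed_iInter fun x => hK.preimage (continuous_apply x)
  exact h1.inter h2

open scoped Matrix.Norms.L2Operator

/-- (σ5, fibre) The Hermitian traceless matrices form a closed subset of `M_N(ℂ)` (topology of the `L²`-operator norm = the product topology).
[cite: Balaban1985Variational, Prop. 7 p.299] -/
theorem isClosed_herm_traceZero (N : ℕ) :
    IsClosed {A : Matrix (Fin N) (Fin N) ℂ | A.conjTranspose = A ∧ A.trace = 0} :=
  (isClosed_eq continuous_id.matrix_conjTranspose continuous_id).inter
    (isClosed_eq (continuous_id.matrix_trace) continuous_const)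

/-- (σ5, the (E1-e) set) Pinned Hermitian-traceless site fields form a closed subset of `S → M_N(ℂ)` (the row `hS` of ✓`exists_unique_exact_corrector_gauge`).
[cite: Balaban1985Variational, Prop. 7 p.299] -/
theorem isClosed_pinned_herm_traceZero {S : Type*} (C : Set S) (N : ℕ) :
    IsClosed {ψ : S → Matrix (Fin N) (Fin N) ℂ | (∀ c ∈ C, ψ c = 0) ∧ ∀ x, (ψ x).conjTranspose = ψ x ∧ (ψ x).trace = 0} :=
  isClosed_pinned_mem C {A : Matrix (Fin N) (Fin N) ℂ | A.conjTranspose = A ∧ A.trace = 0} (isClosed_herm_traceZero N)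

end Closed

/-! ## §3 The E′ reading: `T := torusT P j`, `𝒰 := fun κ z => unitsField (toUField W) ⟨z, κ⟩`, `SU(N)`-valued `W` -/

section Torus

open scoped Matrix.Norms.L2Operator
open B10Eq27TorusAxialLog (unitsField toUField unitsField_mem_unitaryUnits)
open B9TorusCalculus (torusT)

variable {P : Params} {j : ℕ} {N : ℕ} [NeZero N]

/-- The background letters of the (E1) row are operator-norm contractions: `‖W(b)‖ ≤ 1` and `‖W(b)⁻¹‖ ≤ 1` for `SU(N)`-valued `W` read in the units of `M_N(ℂ)`.
[cite: Balaban1985Variational, (6) p.278] -/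
theorem unitsField_toUField_norm_le_one (W : GaugeField P j (Matrix.specialUnitaryGroup (Fin N) ℂ)) (b : PBond P j) :
    ‖(unitsField (toUField W) b : Matrix (Fin N) (Fin N) ℂ)‖ ≤ 1 ∧ ‖(((unitsField (toUField W) b)⁻¹ : (Matrix (Fin N) (Fin N) ℂ)ˣ) : Matrix (Fin N) (Fin N) ℂ)‖ ≤ 1 := by
  letI : CStarAlgebra (Matrix (Fin N) (Fin N) ℂ) := B10Eq29TubeLine.cstarAlgebraMatrix N
  exact B7Prop1Explicit.mem_U1.mp (B7Prop2Explicit.unitaryUnits_le_U1 (unitsField_mem_unitaryUnits (toUField W) b))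

/-- (σ3′) `‖D_Wψ‖ ≤ 2‖ψ‖` for the covariant difference of the (E1) row (`Pi` sup norms, `L²`-operator norm on the fibre).  [cite: Balaban1985BackgroundPropagators, (3.3) p.390] -/
theorem norm_covD_field_le_T (W : GaugeField P j (Matrix.specialUnitaryGroup (Fin N) ℂ)) (ψ : Site P j → Matrix (Fin N) (Fin N) ℂ) :
    ‖(fun μ z => covD (torusT P j) (fun κ z => unitsField (toUField W) ⟨z, κ⟩) μ ψ z)‖ ≤ 2 * ‖ψ‖ :=
  norm_covD_field_le (torusT P j) (fun κ z => unitsField (toUField W) ⟨z, κ⟩) (fun μ z => unitsField_toUField_norm_le_one W ⟨z, μ⟩) ψ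

/-- (σ4′) `‖Δ_Wψ‖ ≤ 4d‖ψ‖` for `Δ_W = divB ∘ covD` of the (E1) row.  [cite: Balaban1985BackgroundPropagators, (3.8) p.392] -/
theorem norm_lapW_field_le_T (W : GaugeField P j (Matrix.specialUnitaryGroup (Fin N) ℂ)) (ψ : Site P j → Matrix (Fin N) (Fin N) ℂ) :
    ‖(fun x => divB (torusT P j) (fun κ z => unitsField (toUField W) ⟨z, κ⟩)
        (fun μ z => covD (torusT P j) (fun κ z => unitsField (toUField W) ⟨z, κ⟩) μ ψ z) x)‖ ≤ 4 * P.d * ‖ψ‖ := by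
  have h := norm_lapW_field_le (torusT P j) (fun κ z => unitsField (toUField W) ⟨z, κ⟩) (fun μ z => unitsField_toUField_norm_le_one W ⟨z, μ⟩) ψ
  simpa [Fintype.card_fin] using h

omit [NeZero N] in
/-- (σ6) The site-field carrier `Site P j → M_N(ℂ)` is complete (the instance `[CompleteSpace X]` of ✓`exists_unique_exact_corrector_gauge`; by instance search, recorded for the knit's
`haveI`).  [cite: Balaban1985Variational, Prop. 7 p.299] -/
theorem completeSpace_siteField : CompleteSpace (Site P j → Matrix (Fin N) (Fin N) ℂ) := inferInstance

end Torus

/-! ## §4 (v1.1) The weighted second-order row `ρ₃` (X-row 3 of the (E1) scheme of record after the pin-cone cure) -/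

section Weighted

variable {𝔸 : Type*} [NormedRing 𝔸] [NormedAlgebra ℂ 𝔸] {S : Type*} {ι : Type*} [Fintype ι]
variable (T : ι → Equiv.Perm S) (U : ι → S → 𝔸ˣ)

/-- (σ2ʷ) Additivity of the WEIGHTED covariant Laplacian `ψ ↦ (x ↦ w(x)·Δ_Uψ(x))` (real weight cast into `ℂ`), the map behind `ρ₃(ψ) = ℓ·sup_x w(x)‖Δ_Wψ(x)‖`.
[cite: Balaban1985BackgroundPropagators, (3.8) p.392] -/
theorem wlapW_field_sub (w : S → ℝ) (a b : S → 𝔸) :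
    (fun x => ((w x : ℝ) : ℂ) • divB T U (fun μ z => covD T U μ (a - b) z) x) =
      (fun x => ((w x : ℝ) : ℂ) • divB T U (fun μ z => covD T U μ a z) x) - (fun x => ((w x : ℝ) : ℂ) • divB T U (fun μ z => covD T U μ b z) x) := by
  funext x
  simp only [Pi.sub_apply]
  rw [covD_field_sub T U a b, divB_sub, smul_sub]

variable [Fintype S]

/-- (σ4ʷ) `‖(x ↦ w(x)·Δ_Uψ(x))‖ ≤ wmax·4|ι|·‖ψ‖` for a weight `0 ≤ w ≤ wmax` and a background with `‖U‖, ‖U⁻¹‖ ≤ 1` (the row `hb₂` of ✓`Prop7GaugeRowsMaxSup.gauge_le_mul_norm` for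
the weighted `T₂`, `a₂ := wmax·4|ι|`).  [cite: Balaban1985BackgroundPropagators, (3.8) p.392] -/
theorem norm_wlapW_field_le (hU : ∀ μ z, ‖(U μ z : 𝔸)‖ ≤ 1 ∧ ‖(((U μ z)⁻¹ : 𝔸ˣ) : 𝔸)‖ ≤ 1) {w : S → ℝ} {wmax : ℝ}
    (hw0 : ∀ x, 0 ≤ w x) (hw : ∀ x, w x ≤ wmax) (ψ : S → 𝔸) :
    ‖(fun x => ((w x : ℝ) : ℂ) • divB T U (fun μ z => covD T U μ ψ z) x)‖ ≤ wmax * (4 * Fintype.card ι) * ‖ψ‖ := by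
  rcases isEmpty_or_nonempty S with hS | hS
  · have hf : (fun x => ((w x : ℝ) : ℂ) • divB T U (fun μ z => covD T U μ ψ z) x) = 0 := funext fun x => (IsEmpty.false x).elim
    have hψ : ψ = 0 := funext fun x => (IsEmpty.false x).elim
    rw [hf, norm_zero, hψ, norm_zero, mul_zero]
  · obtain ⟨x₀⟩ := hS
    have hwmax : 0 ≤ wmax := (hw0 x₀).trans (hw x₀)
    refine (pi_norm_le_iff_of_nonneg (by positivity)).2 fun x => ?_
    rw [norm_smul, Complex.norm_real, Real.norm_of_nonneg (hw0 x)]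
    calc w x * ‖divB T U (fun μ z => covD T U μ ψ z) x‖ ≤ w x * (4 * Fintype.card ι * ‖ψ‖) :=
          mul_le_mul_of_nonneg_left (norm_lapW_le T U hU ψ x) (hw0 x)
      _ ≤ wmax * (4 * Fintype.card ι * ‖ψ‖) := mul_le_mul_of_nonneg_right (hw x) (by positivity)
      _ = wmax * (4 * Fintype.card ι) * ‖ψ‖ := by ring

end Weighted

section TorusWeighted

open scoped Matrix.Norms.L2Operator
open B10Eq27TorusAxialLog (unitsField toUField)
open B9TorusCalculus (torusT)

variable {P : Params} {j : ℕ} {N : ℕ} [NeZero N]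

/-- (σ4ʷ′) The E′ reading: `‖(x ↦ w(x)·Δ_Wψ(x))‖ ≤ wmax·4d·‖ψ‖` at `𝒰 := fun κ z => unitsField (toUField W) ⟨z, κ⟩` — with `w := min(dist(·,C), ℓ)`, `wmax := ℓ` this is the
`hb₂` socket of `ρ₃`.  [cite: Balaban1985BackgroundPropagators, (3.8) p.392] -/
theorem norm_wlapW_field_le_T (W : GaugeField P j (Matrix.specialUnitaryGroup (Fin N) ℂ)) {w : Site P j → ℝ} {wmax : ℝ}
    (hw0 : ∀ x, 0 ≤ w x) (hw : ∀ x, w x ≤ wmax) (ψ : Site P j → Matrix (Fin N) (Fin N) ℂ) :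
    ‖(fun x => ((w x : ℝ) : ℂ) • divB (torusT P j) (fun κ z => unitsField (toUField W) ⟨z, κ⟩)
        (fun μ z => covD (torusT P j) (fun κ z => unitsField (toUField W) ⟨z, κ⟩) μ ψ z) x)‖ ≤ wmax * (4 * P.d) * ‖ψ‖ := by
  letI : CStarAlgebra (Matrix (Fin N) (Fin N) ℂ) := B10Eq29TubeLine.cstarAlgebraMatrix N
  have h := norm_wlapW_field_le (torusT P j) (fun κ z => unitsField (toUField W) ⟨z, κ⟩)
    (fun μ z => unitsField_toUField_norm_le_one W ⟨z, μ⟩) hw0 hw ψ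
  simpa [Fintype.card_fin] using h

end TorusWeighted

end Summit.QuantumFields.YangMills.Theorems.Prop7ExactCorrectorGaugeSockets
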